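import Summits.ABC.ABC.Theses.DefiniteXi
import Summits.ABC.ABC.Theses.IsogenyGlueCongruence
import Summits.ABC.ABC.Theses.RibetTakahashiSplit
import Summits.ABC.ABC.Theorems.DefiniteXiDefiniteRTControlPrimeOfTakahashi
import Summits.ABC.ABC.Theorems.IsogenyGlueCongruenceMazurKenkuBoundOfLiteInputs
import Summits.ABC.ABC.Theorems.IsogenyGlueCongruenceMazurKenkuBoundOfEightTables
import Summits.ABC.ABC.Theorems.IsogenyGlueCongruenceMazurKenkuBoundOfRadius
import Summits.ABC.ABC.Theorems.IsogenyGlueCongruenceMazurKenkuBoundSplitGlue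
import Summits.ABC.ABC.Theorems.IsogenyGlueCongruenceKenkuCompositeTables
import Summits.ABC.ABC.Theorems.IsogenyGlueCongruenceKenkuLevelFortyNine
import Summits.ABC.ABC.Theorems.IsogenyGlueCongruenceKenkuPrintedLevelsOfThreeLevels
import Summits.BirchSwinnertonDyer.BirchSwinnertonDyer.Theorems.ManinLocalTwoThreeManinPrimeToAdditiveFiveLeAcrossIsogenyOfStrongIsUnstarred
import Summits.BirchSwinnertonDyer.Rank1Residual.X2.IsogenyQuotientLine
import Literature.NumberTheory.EllipticCurves.RationalIsogenyPrimeDegreeJInvariants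
import Literature.NumberTheory.EllipticCurves.PrimeDegreeIsogenyJTable
import Literature.NumberTheory.EllipticCurves.OpenImage
import Literature.NumberTheory.EllipticCurves.OpenImageMazurInputs
import Literature.NumberTheory.EllipticCurves.OpenImageMazurInputsProofs
import Literature.NumberTheory.EllipticCurves.OpenImageMazurProofs
import HarnessLib

/-!
# STUB-IDEAS k1 · gen 28 — `stub_pasten163`: the Mazur-debt BRIDGE, now with every piece LANDED or XS

Crux stmt-ABC-11338 `DefiniteXi.DefiniteRTControlPrime`; stub
`stub_pasten163 : PastenShimura2024_minimalDegree_le_163_mul` (≡ item stmt-ABC-15125 `MazurKenkuBound`, `Iff.rfl`).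
Scratch of an ideation seat (FAMILY 1 — recognise & import). Gen-27 left H1/H2/H3 `sorry`ed and rated the
converse H4 "M, not in tree". Gen 28 TREE MATCH: (E1) "prime-degree isogeny ⇒ `E[p]` reducible" is LANDED in the
BSD cell (`Summit.BirchSwinnertonDyer.BirchSwinnertonDyer.Theorems.not_hasIrreducibleModPGaloisRep_of_isogeny_degree_prime`);
(E2) its converse "reducible ⇒ a degree-`p` isogeny onto a globally minimal curve" is two landed theorems
(`Mazur1978.not_hasIrreducibleModPGaloisRep_iff_exists_natCard_eq` + `X2.IsogenyQuotientLine.exists_isogeny_ker_eq_line`,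
i.e. AEC III.4.12 `exists_isogeny_ker_eq_and_comp_eq_nsmul_holds`). With them H2, H3, H4 are short and the
cross-summit equivalence `mazur_j_mem_… ↔ mazur_isogeny_irreducible ∧ primeDegreeIsogeny_jTable` is in reach.
-/

set_option linter.dupNamespace false

noncomputable section

namespace Summit.ABC.ABC.Cruxes.DefiniteRTControlPrime.StubIdeasK1G28

open WeierstrassCurve
open Literature.NumberTheory.EllipticCurves Literature.NumberTheory.EllipticCurves.ModularForms
open Summit.ABC.ABC.Theorems

/-! ## Doors re-checked (gen 20/27), by name -/

/-- D0 · the stub IS the item `MazurKenkuBound` (both route copies). -/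
theorem door_item_defeq :
    Summit.ABC.ABC.Theses.IsogenyGlueCongruence.MazurKenkuBound ↔
      PastenShimura2024_minimalDegree_le_163_mul :=
  Iff.rfl

/-- I1 · idleness: the crux BY NAME from Takahashi 2001 Thm 2.3 alone (p839521). -/
theorem crux_of_takahashi :
    takahashi2001_thm_2_3_of_coprime → Summit.ABC.ABC.Theses.DefiniteXi.DefiniteRTControlPrime :=
  Summit.ABC.ABC.Theorems.DefiniteRTControlPrime.definiteRTControlPrime_of_takahashi

/-! ## E1 / E2 — the two directions "degree-`p` isogeny ↔ `E[p]` reducible", both from LANDED theorems -/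

/-- E1 (LANDED in the BSD cell, re-exported by name): a `ℚ`-isogeny of prime degree `p` makes `E[p]` reducible. -/
theorem E1_reducible_of_isogeny_degree_prime {W W' : WeierstrassCurve ℚ} [W.IsElliptic] [W'.IsElliptic]
    {p : ℕ} [Fact p.Prime] (φ : Isogeny W W') (hdeg : φ.degree = p) :
    ¬ W.HasIrreducibleModPGaloisRep p :=
  Summit.BirchSwinnertonDyer.BirchSwinnertonDyer.Theorems.not_hasIrreducibleModPGaloisRep_of_isogeny_degree_prime
    φ hdeg

/-- E2 (XS; AEC III.4.12 + Néron minimal model, both landed): reducible `E[p]` gives a `ℚ`-isogeny of degree `p`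
onto a globally minimal curve. -/
theorem E2_exists_isogeny_degree_eq_of_reducible (W : WeierstrassCurve ℚ) [W.IsElliptic] (p : ℕ)
    [hp : Fact p.Prime] (hred : ¬ W.HasIrreducibleModPGaloisRep p) :
    ∃ (W₂ : WeierstrassCurve ℚ) (_ : W₂.IsElliptic) (_ : W₂.IsGloballyMinimal) (φ : Isogeny W W₂),
      φ.degree = p := by
  haveI : NeZero ((p : ℕ) : ℚ) := ⟨Nat.cast_ne_zero.mpr hp.out.ne_zero⟩
  obtain ⟨H, hHstab, hHcard⟩ :=
    (Mazur1978.not_hasIrreducibleModPGaloisRep_iff_exists_natCard_eq W p).mp hred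
  obtain ⟨W₂, hW₂, hmin, g, -, hdeg⟩ :=
    Summit.BirchSwinnertonDyer.Rank1Residual.X2.IsogenyQuotientLine.exists_isogeny_ker_eq_line
      (W := W) (p := p) (Φ₀ := H) ⟨hHcard, hHstab⟩
  exact ⟨W₂, hW₂, hmin, g, hdeg⟩

/-! ## H2 / H3 — the BSD-cell named fact `mazur_j_mem_…` implies BOTH Mazur inputs of the ABC chain -/

/-- H2 (XS): Mazur's Thm 1 in Galois-image form from the BSD-cell fact: a prime outside Mazur's list is `≥ 23`,
so `11 ≤ p`, `p ≠ 13`, and the fact's conclusion would put `p` back in the list. -/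
theorem H2_mazurThm1_of_jMem (hMz : mazur_j_mem_of_not_hasIrreducibleModPGaloisRep_of_eleven_le) :
    mazur_isogeny_irreducible := by
  intro W _ p hp hnot
  by_contra hred
  haveI : Fact p.Prime := ⟨hp⟩
  have h11 : 11 ≤ p := by
    by_contra hlt
    push Not at hlt
    interval_cases p <;> first
      | exact absurd hp (by decide)
      | exact hnot (by simp [mazurPrimes])
  have h13 : p ≠ 13 := by
    rintro rfl
    exact hnot (by simp [mazurPrimes])
  rcases hMz W p h11 h13 hred with ⟨rfl, -⟩ | ⟨rfl, -⟩ | ⟨rfl, -⟩ | ⟨rfl, -⟩ | ⟨rfl, -⟩ | ⟨rfl, -⟩ |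
      ⟨rfl, -⟩ <;>
    exact hnot (by simp [mazurPrimes])

/-- H3 (XS with E1): the seven prime `j`-tables from the BSD-cell fact. -/
theorem H3_primeTables_of_jMem (hMz : mazur_j_mem_of_not_hasIrreducibleModPGaloisRep_of_eleven_le) :
    primeDegreeIsogeny_jTable := by
  intro V V' _ _ ψ hmem
  have hℓ : ψ.degree = 11 ∨ ψ.degree = 17 ∨ ψ.degree = 19 ∨ ψ.degree = 37 ∨ ψ.degree = 43 ∨
      ψ.degree = 67 ∨ ψ.degree = 163 := by
    simpa only [Finset.mem_insert, Finset.mem_singleton] using hmem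
  have hprime : ψ.degree.Prime := by
    rcases hℓ with h | h | h | h | h | h | h <;> rw [h] <;> norm_num
  haveI : Fact ψ.degree.Prime := ⟨hprime⟩
  have hred : ¬ V.HasIrreducibleModPGaloisRep ψ.degree := E1_reducible_of_isogeny_degree_prime ψ rfl
  have h11 : 11 ≤ ψ.degree := by rcases hℓ with h | h | h | h | h | h | h <;> omega
  have h13 : ψ.degree ≠ 13 := by rcases hℓ with h | h | h | h | h | h | h <;> omega
  have hrow := hMz V ψ.degree h11 h13 hred
  rcases hrow with ⟨hd, hj | hj | hj⟩ | ⟨hd, hj | hj⟩ | ⟨hd, hj⟩ | ⟨hd, hj | hj⟩ | ⟨hd, hj⟩ |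
      ⟨hd, hj⟩ | ⟨hd, hj⟩ <;>
    (rw [hd, hj]; decide +kernel)

/-! ## H4 — the converse: Mazur Thm 1 + the seven prime tables give the BSD-cell fact back -/

/-- H4 (S with E2): for `p ≥ 11`, `p ≠ 13` and `E[p]` reducible, E2 gives a degree-`p` isogeny; if `p` is a Mazur
prime the table row is the fact's disjunct, otherwise Mazur's Thm 1 contradicts reducibility. -/
theorem H4_jMem_of_mazurThm1_of_primeTables (hMI : mazur_isogeny_irreducible)
    (hT : primeDegreeIsogeny_jTable) :
    mazur_j_mem_of_not_hasIrreducibleModPGaloisRep_of_eleven_le := by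
  intro W _ p _ h11 h13 hred
  have hp : p.Prime := Fact.out
  by_cases hmem : p ∈ mazurPrimes
  · obtain ⟨W₂, hW₂, -, φ, hdeg⟩ := E2_exists_isogeny_degree_eq_of_reducible W p hred
    have hp7 : p = 11 ∨ p = 17 ∨ p = 19 ∨ p = 37 ∨ p = 43 ∨ p = 67 ∨ p = 163 := by
      simp only [mazurPrimes, Finset.mem_insert, Finset.mem_singleton] at hmem
      omega
    have hmem7 : φ.degree ∈ ({11, 17, 19, 37, 43, 67, 163} : Finset ℕ) := by
      rw [hdeg]
      simp only [Finset.mem_insert, Finset.mem_singleton]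
      omega
    have hrow := hT W W₂ φ hmem7
    rw [hdeg] at hrow
    rcases hp7 with rfl | rfl | rfl | rfl | rfl | rfl | rfl
    all_goals
      simp only [largePrimeIsogenyJTable, Finset.mem_insert, Finset.mem_singleton, Prod.mk.injEq] at hrow
      norm_num at hrow
      norm_num [hrow]
  · exact absurd (hMI W p hp hmem) hred

/-- H5 (landed term): Mazur's Cor. 4.4 (item stmt-ABC-18223 `MazurCor44`) + the PROVED Prop. 5.1 give Thm 1. -/
theorem H5_mazurThm1_of_cor44 (h44 : Summit.ABC.ABC.Theses.IsogenyGlueCongruence.MazurCor44) :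
    mazur_isogeny_irreducible :=
  mazur_isogeny_irreducible_holds_of h44 Mazur1978.prop51_exponent_classes_of_additive_holds

/-- **BRIDGE** (cross-summit dedup): the BSD-cell fact ⟺ Mazur Thm 1 ∧ the seven prime `j`-tables. -/
theorem jMem_iff_mazurThm1_and_primeTables :
    mazur_j_mem_of_not_hasIrreducibleModPGaloisRep_of_eleven_le ↔
      (mazur_isogeny_irreducible ∧ primeDegreeIsogeny_jTable) :=
  ⟨fun h ↦ ⟨H2_mazurThm1_of_jMem h, H3_primeTables_of_jMem h⟩,
    fun h ↦ H4_jMem_of_mazurThm1_of_primeTables h.1 h.2⟩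

/-- Corollary: the IGC leaves (stmt-ABC-18223 + the prime-table half of stmt-ABC-18224) discharge the BSD-cell fact. -/
theorem jMem_of_cor44_of_primeTables (h44 : Summit.ABC.ABC.Theses.IsogenyGlueCongruence.MazurCor44)
    (hT : primeDegreeIsogeny_jTable) :
    mazur_j_mem_of_not_hasIrreducibleModPGaloisRep_of_eleven_le :=
  H4_jMem_of_mazurThm1_of_primeTables (H5_mazurThm1_of_cor44 h44) hT

/-! ## H1 — the stub's item from Mazur Thm 1 (Galois form) in the `h44` slot: pure assembly of landed closers -/

/-- glue (XS): the cyclic seven-row form `hT7` from `primeDegreeIsogeny_jTable` (cyclicity dropped). -/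
theorem hT7_of_primeTables (hT : primeDegreeIsogeny_jTable) :
    ∀ (V V' : WeierstrassCurve ℚ) [V.IsElliptic] [V'.IsElliptic] (ψ : Isogeny V V'),
      ψ.IsCyclic → ψ.degree ∈ ({11, 17, 19, 37, 43, 67, 163} : Finset ℕ) →
        (ψ.degree, V.j) ∈ ({((11 : ℕ), (-32768 : ℚ)), (11, -121), (11, -24729001),
          (17, -297756989 / 2), (17, -882216989 / 131072), (19, -884736), (37, -9317),
          (37, -162677523113838677), (43, -884736000), (67, -147197952000),
          (163, -262537412640768000)} : Finset (ℕ × ℚ)) :=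
  fun V V' _ _ ψ _ h ↦ hT V V' ψ h

/-- H1 (S, assembly only — the body of `mazurKenkuBoundGlue_proof` one level down, with
`mazur_isogeny_irreducible` where `mazur_isogeny_irreducible_holds_of h44 …` stood): the stub's item from Mazur's
Thm 1, Klein–Fricke at `13`, the seven prime `j`-tables and the three levels `65, 125, 169`. -/
theorem H1_mazurKenkuBound_of_mazurThm1 (hMI : mazur_isogeny_irreducible)
    (h13 : kleinFrickeThirteen_exists_j_eq)
    (hT7 : ∀ (V V' : WeierstrassCurve ℚ) [V.IsElliptic] [V'.IsElliptic] (ψ : Isogeny V V'),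
      ψ.IsCyclic → ψ.degree ∈ ({11, 17, 19, 37, 43, 67, 163} : Finset ℕ) →
        (ψ.degree, V.j) ∈ ({((11 : ℕ), (-32768 : ℚ)), (11, -121), (11, -24729001),
          (17, -297756989 / 2), (17, -882216989 / 131072), (19, -884736), (37, -9317),
          (37, -162677523113838677), (43, -884736000), (67, -147197952000),
          (163, -262537412640768000)} : Finset (ℕ × ℚ)))
    (hL3 : ∀ (V V' : WeierstrassCurve ℚ) [V.IsElliptic] [V'.IsElliptic] (ψ : Isogeny V V'),
      ψ.IsCyclic → ψ.degree ∉ ({65, 125, 169} : Finset ℕ)) :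
    Summit.ABC.ABC.Theses.IsogenyGlueCongruence.MazurKenkuBound := by
  have hB : Summit.ABC.ABC.Theses.IsogenyGlueCongruence.KenkuPrintedLevels :=
    kenkuPrintedLevels_of_kleinFricke13_of_primeTables_of_threeLevels h13 hT7 hL3
  have hC₁ : Summit.ABC.ABC.Theses.IsogenyGlueCongruence.KenkuCompositeTables := kenkuCompositeTables_proof
  have hC₂ : Summit.ABC.ABC.Theses.IsogenyGlueCongruence.KenkuLevelFortyNine := kenkuLevelFortyNine_proof
  have hK7 : ∀ (W W' : WeierstrassCurve ℚ) [W.IsElliptic] (φ : Isogeny W W'), φ.degree = 7 →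
      ∃ t : ℚ, t ≠ 0 ∧ W.j = (t ^ 2 + 13 * t + 49) * (t ^ 2 + 5 * t + 1) ^ 3 / t :=
    fun W W' _ φ h7 ↦ φ.exists_j_eq_klein_seven_of_degree_eq_seven h7
      (φ.j_ne_zero_of_degree_eq_seven_rat h7)
  -- `hT8`: the eight non-`15, 21` table levels
  have hT8 : ∀ (V V' : WeierstrassCurve ℚ) [V.IsElliptic] [V'.IsElliptic] (ψ : Isogeny V V'),
      ψ.IsCyclic → ψ.degree ∈ ({11, 17, 19, 27, 37, 43, 67, 163} : Finset ℕ) →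
        (ψ.degree, V.j) ∈ kenkuIsogenyJTable := by
    intro V V' _ _ ψ hψ hmem
    have hsplit : ∀ n ∈ ({11, 17, 19, 27, 37, 43, 67, 163} : Finset ℕ),
        n = 27 ∨ n ∈ ({11, 17, 19, 37, 43, 67, 163} : Finset ℕ) := by decide
    rcases hsplit _ hmem with h27 | h7
    · have h := hC₁ V V' ψ hψ (by rw [h27]; decide)
      exact splitRows_sub_kenkuIsogenyJTable _ (Finset.mem_of_subset (by decide +kernel) h)
    · have h := hB.1 V V' ψ hψ h7
      exact splitRows_sub_kenkuIsogenyJTable _ (Finset.mem_of_subset (by decide +kernel) h)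
  -- `hL6`: the six smooth levels
  have hL6 : ∀ (V V' : WeierstrassCurve ℚ) [V.IsElliptic] [V'.IsElliptic] (ψ : Isogeny V V'),
      ψ.IsCyclic → ψ.degree ∉ ({26, 35, 49, 65, 125, 169} : Finset ℕ) := by
    intro V V' _ _ ψ hψ hmem
    have hsplit : ∀ n ∈ ({26, 35, 49, 65, 125, 169} : Finset ℕ),
        n = 49 ∨ n ∈ ({26, 35, 65, 125, 169} : Finset ℕ) := by decide
    rcases hsplit _ hmem with h49 | h5
    · exact hC₂ V V' ψ hψ h49
    · exact hB.2 V V' ψ hψ h5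
  exact mazurKenkuBound_of_radiusItem
    (fun W W' _ _ hW ↦ stub_radius_of_mazur_of_barrier _ lite_covers
      (lite_hexcl (jTables_of_eight hT8 hK7) hL6) hMI W W' hW)

/-! ## D7 — the door for the stub -/

/-- **D7**: `stub_pasten163` from ONE named fact of the BSD cell (Mazur 1978 Thm 1 + table p. 129, as stated)
+ Klein–Fricke at `13` (cite-only) + the three genus-`≥ 2` levels `65, 125, 169` (item stmt-ABC-18224's residue). -/
theorem D7_stub_pasten163_of_jMem
    (hMz : mazur_j_mem_of_not_hasIrreducibleModPGaloisRep_of_eleven_le)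
    (h13 : kleinFrickeThirteen_exists_j_eq)
    (hL3 : ∀ (V V' : WeierstrassCurve ℚ) [V.IsElliptic] [V'.IsElliptic] (ψ : Isogeny V V'),
      ψ.IsCyclic → ψ.degree ∉ ({65, 125, 169} : Finset ℕ)) :
    PastenShimura2024_minimalDegree_le_163_mul :=
  H1_mazurKenkuBound_of_mazurThm1 (H2_mazurThm1_of_jMem hMz) h13
    (hT7_of_primeTables (H3_primeTables_of_jMem hMz)) hL3

/-- D5 (unchanged finest ABC-side door, for comparison): the two OPEN split children of stmt-ABC-15125. -/
theorem D5_stub_pasten163_of_split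
    (h44 : Summit.ABC.ABC.Theses.IsogenyGlueCongruence.MazurCor44)
    (hK : Summit.ABC.ABC.Theses.IsogenyGlueCongruence.KenkuPrintedLevels) :
    PastenShimura2024_minimalDegree_le_163_mul :=
  mazurKenkuBoundGlue_proof h44 hK kenkuCompositeTables_proof kenkuLevelFortyNine_proof

#print axioms E2_exists_isogeny_degree_eq_of_reducible
#print axioms jMem_iff_mazurThm1_and_primeTables
#print axioms D7_stub_pasten163_of_jMem

end Summit.ABC.ABC.Cruxes.DefiniteRTControlPrime.StubIdeasK1G28

end
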